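import Literature.NumberTheory.GaloisRepresentations.TriangulineVariety

/-!
# The trianguline-variety interface: `RegularIsOpenDense` is a hypothesis schema

Companion ("proofs") file of `TriangulineVariety.lean` (the interface
`TriangulineVariety K p O k ρ̄` of the Breuil–Hellmann–Schraen trianguline variety `X_tri^□(ρ̄)`),
holding proved statements about its property predicates.

## `RegularIsOpenDense` (BHS Th. 2.6 (ii)) is a predicate on the datum, not a closed fact

BHS Th. 2.6 (ii) — "`U_tri^□(ρ̄)^reg` est un ouvert de Zariski … Zariski-dense dans `X_tri^□(ρ̄)`" —
is a theorem about the GENUINE reduced rigid space `X_tri^□(ρ̄)`.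
[cite: BreuilHellmannSchraen2017Trianguline, Th. 2.6 (ii)]
Over the interface, a `TriangulineVariety K p O k ρ̄` is ANY datum
`(Pt, topology, r, δ, reducesTo, injective, isLocallyConstant_param_torsionType, regular)`, and no
structure axiom mentions the field `regular`.  Accordingly the declaration
`TriangulineVariety.RegularIsOpenDense` elaborates to
`TriangulineVariety K p O k ρ̄ → Prop` — a parametrised predicate consumed as the hypothesis
`(h : X.RegularIsOpenDense)` by the route `Langlands/TriangulineChamber`, exactly like
`IsEquidimensional`, `PointsOfRegular`, `HasAllRegularPoints`, `BorelLocusClopen` — and NOT a closed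
named fact: there is no `RegularIsOpenDense_holds` and none can exist.  This file records why,
machine-checked:

* `regularIsOpenDense_iff` — unfolding;
* `RegularIsOpenDense.of_regular_eq_univ`, `regularIsOpenDense_withRegularUniv` — the predicate is
  satisfiable over every `ρ̄` admitting a datum (re-decorate any datum by `regular := univ`);
* `not_regularIsOpenDense_of_regular_eq_empty`, `not_regularIsOpenDense_withRegularEmpty` — it
  fails for the re-decoration `regular := ∅` of any datum with a point (every rank, every `ρ̄`);
* `not_forall_regularIsOpenDense`, `not_forall_forall_regularIsOpenDense` — its universal closure
  is false outright: in rank `0` the one-point datum (trivial `r : 𝒢_K →ₜ* GL_0(ℚ̄_p)`, empty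
  parameter tuple, discrete topology, `regular = ∅`) is a value of the structure over any
  `ρ̄ : 𝒢_K →ₜ* GL_0(k)`.

(The construction of the genuine `X_tri^□(ρ̄)` as such a datum, which would turn Th. 2.6 (ii) into
a closed statement, needs rigid-analytic geometry, absent from Mathlib; over the bare interface an
existence statement is vacuous, `Pt = ∅` having every property — see the module docstring of
`TriangulineVariety.lean`, "Deliberately NOT here".  Facts-census note: `RegularIsOpenDense` is a
`def … : Prop` under `variable (X : TriangulineVariety …)`, hence a census-regex artefact, of the
same kind as `Resolution.FracCompat` / `not_forall_fracCompat`.)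

## References

* C. Breuil, E. Hellmann, B. Schraen, *Une interprétation modulaire de la variété trianguline*,
  Math. Ann. 367 (2017), arXiv:1411.7260, Déf. 2.4 and Th. 2.6.
  [BreuilHellmannSchraen2017Trianguline]
-/

noncomputable section

namespace Literature.NumberTheory.GaloisRepresentations

namespace TriangulineVariety

variable {K : Type} [Field K] [ValuativeRel K] [TopologicalSpace K] [IsNonarchimedeanLocalField K]
  {p : ℕ} [Fact p.Prime] {O : Type} [CommRing O] [Algebra O (PadicAlgCl p)] {k : Type} [Field k]
  [Algebra O k] [TopologicalSpace k] {n : ℕ} {ρbar : ModPGaloisRep K k n}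
  (X : TriangulineVariety K p O k ρbar)

/-- Unfolding lemma for `RegularIsOpenDense`: the regular locus is open and dense for the analytic
Zariski topology of the datum. [cite: BreuilHellmannSchraen2017Trianguline, Th. 2.6 (ii)] -/
lemma regularIsOpenDense_iff : X.RegularIsOpenDense ↔ IsOpen X.regular ∧ Dense X.regular :=
  Iff.rfl

/-- A datum whose regular locus is everything satisfies `RegularIsOpenDense`. [folklore] -/
theorem RegularIsOpenDense.of_regular_eq_univ (h : X.regular = Set.univ) :
    X.RegularIsOpenDense := by
  rw [regularIsOpenDense_iff, h]
  exact ⟨isOpen_univ, dense_univ⟩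

/-- A datum with a point whose regular locus is empty violates `RegularIsOpenDense` (the empty set
is not dense in a nonempty space). [folklore] -/
theorem not_regularIsOpenDense_of_regular_eq_empty [Nonempty X.Pt] (h : X.regular = ∅) :
    ¬ X.RegularIsOpenDense := by
  rw [regularIsOpenDense_iff, h]
  rintro ⟨-, hd⟩
  exact Set.not_nonempty_empty hd.nonempty

/-- **Re-decoration by `univ`.**  Replacing the regular locus of a datum by `Set.univ` — same
points, same analytic Zariski topology, same `r_x` and `δ_x`; every structure axiom is kept since
none mentions `regular` — gives a datum satisfying `RegularIsOpenDense`: the predicate is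
satisfiable over every `ρ̄` that admits a datum at all. [folklore] -/
theorem regularIsOpenDense_withRegularUniv :
    ({ X with regular := Set.univ } : TriangulineVariety K p O k ρbar).RegularIsOpenDense :=
  RegularIsOpenDense.of_regular_eq_univ _ rfl

/-- **Re-decoration by `∅`.**  Replacing the regular locus of a datum with a point by `∅` gives a
datum violating `RegularIsOpenDense`: in every rank, over every `ρ̄` admitting a datum with a point,
the predicate fails for some datum — it is a genuine hypothesis on `X`, independent of the
structure axioms. [folklore] -/
theorem not_regularIsOpenDense_withRegularEmpty [Nonempty X.Pt] :
    ¬ ({ X with regular := ∅ } : TriangulineVariety K p O k ρbar).RegularIsOpenDense :=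
  not_regularIsOpenDense_of_regular_eq_empty
    ({ X with regular := (∅ : Set X.Pt) } : TriangulineVariety K p O k ρbar) rfl

/-- **The universal closure of `RegularIsOpenDense` is false.**  In rank `0`, over any
`ρ̄ : 𝒢_K →ₜ* GL_0(k)`, the one-point datum — `Pt = Unit` with the discrete topology, the trivial
`r : 𝒢_K →ₜ* GL_0(ℚ̄_p)` (vacuously an `O`-integral lift of `ρ̄`: there are no matrix entries), the
empty parameter tuple (whose torsion type is constant, hence locally constant), and `regular = ∅` —
is a value of the structure and violates the predicate.  Hence no
`theorem RegularIsOpenDense_holds` can exist: BHS Th. 2.6 (ii) enters the tree only as the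
hypothesis `(h : X.RegularIsOpenDense)` on a datum `X`. [folklore] -/
theorem not_forall_regularIsOpenDense (ρ0 : ModPGaloisRep K k 0) :
    ¬ ∀ X : TriangulineVariety K p O k ρ0, X.RegularIsOpenDense := by
  intro h
  let X0 : TriangulineVariety K p O k ρ0 :=
    { Pt := Unit
      topology := ⊥
      galoisRep := fun _ => 1
      param := fun _ => fun i => i.elim0
      reducesTo := fun _ _ i => i.elim0
      injective := fun _ _ _ => Subsingleton.elim _ _
      isLocallyConstant_param_torsionType := IsLocallyConstant.const _
      regular := ∅ }
  haveI : Nonempty X0.Pt := ⟨()⟩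
  exact not_regularIsOpenDense_of_regular_eq_empty X0 rfl (h X0)

/-- The same with `ρ̄` quantified as well: "every trianguline-variety datum has open dense regular
locus" is refutable outright (take the trivial `ρ̄ : 𝒢_K →ₜ* GL_0(k)`). [folklore] -/
theorem not_forall_forall_regularIsOpenDense :
    ¬ ∀ (ρ0 : ModPGaloisRep K k 0) (X : TriangulineVariety K p O k ρ0), X.RegularIsOpenDense :=
  fun h => not_forall_regularIsOpenDense (p := p) (O := O) 1 (h 1)

end TriangulineVariety

end Literature.NumberTheory.GaloisRepresentations

end
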